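import Mathlib
import Summits.Ventures.HodgeRepro.Tier4.Common.MixedPlane
import Summits.Ventures.HodgeRepro.Tier4.Common.AdelicPlaces

/-!
# Tier4/Common/MixedPlaneKType — irreducible automorphic subspaces, the local torus at a real place and its
weights (`K`-types), and the mixed plane WITH a transported second torus (t4-plan-4's exact V2 asks (α)(β)(γ),
S12222)

Blind re-derivation cell `pub-hodge-repro`, Tier 4 (README §9–§10), seat t4-typer-2 (gen 0).  Target tree path
`lean/Summits/Ventures/HodgeRepro/Tier4/Common/MixedPlaneKType.lean`.  Imports `Tier4/Common/MixedPlane.lean`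
(`QuadData`, `PlaneData.ofLines`, `IsAutomorphicSubspace`) and `Tier4/Common/AdelicPlaces.lean`
(`GA.finiteComponent`, `GA.infiniteComponent`).

(α) **`IsIrreducibleAutomorphic W V`** — an automorphic subspace, non-zero, with no proper non-zero automorphic
subspace (the irreducibility that makes «two toric periods on ONE τ″» a simultaneity, not two separate theorems).
(β) **`HasKTypeAt`** — the `K`-type of a subspace at a real place `w` of `k`: the elements of `G(𝔸_k)` supported at
`w` (`IsAtPlace w g`: finite components `1`, other infinite components `1`) and lying in the torus form the local
torus `localTorusAt W w`; on each line `⟨a⟩ ⊗_k k_w ≅ ℂ` (the `k_w`-root `ω_w` of `X² − t X + n` with positive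
imaginary part identifies `k_w ⊕ k_w ω` with `ℂ`) an element `κ` of the local torus acts by a complex number
`weightAt q w j κ` (the image of `1` under the block `j`, read in `ℂ` through Mathlib's `extensionEmbedding`);
`HasKTypeAt W q w e₊ e₋ V` := some non-zero `f ∈ V` with `f (x κ) = κ₊^{e₊} κ₋^{e₋} f x` for every `κ` in the local
torus — the DEFINED form of «`V` contains the weight `(e₊, e₋)` at `w`».
(γ) **`PlaneData.withTransportedTorus W g`** — the plane `W` with its second torus replaced by the transport
`g P g⁻¹` of the first along an `E′`-linear invertible `g` (the seesaw isometry): then `torusT` / `torusT'` of the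
result are the two tori `U(W₀) × U(W₂⁻)` and `g (U(W₁) × U(W₃⁻)) g⁻¹` of L4, and ONE `RTFData` carries both periods.

Every object is defined; nothing here is a theorem about the intended objects; nothing here says anything about
the status of the Hodge conjecture for CM abelian varieties, which is NOT proved (HC_CM is NOT proved by anyone in
this repository).
-/

set_option autoImplicit false

noncomputable section

namespace Summit.Ventures.HodgeRepro.Tier4.Common

open NumberField Matrix IsDedekindDomain

section Irreducible

variable {k : Type} [Field k] [NumberField k] (W : PlaneData k)

/-- **(α) An irreducible automorphic subspace**: automorphic, non-zero, and with no automorphic subspace strictly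
between `⊥` and itself. -/
def IsIrreducibleAutomorphic (V : Submodule ℂ (GA W → ℂ)) : Prop :=
  IsAutomorphicSubspace W V ∧ V ≠ ⊥ ∧ ∀ V₀ ≤ V, IsAutomorphicSubspace W V₀ → V₀ = ⊥ ∨ V₀ = V

end Irreducible

section KType

variable {k : Type} [Field k] [NumberField k] (W : PlaneData k)

/-- `g ∈ G(𝔸_k)` is supported at the infinite place `w`: its finite components and its other infinite components are
trivial. -/
def IsAtPlace (w : InfinitePlace k) (g : GA W) : Prop :=
  (∀ v : HeightOneSpectrum (𝓞 k), GA.finiteComponent W v g = 1) ∧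
    ∀ w' : InfinitePlace k, w' ≠ w → GA.infiniteComponent W w' g = 1

/-- The elements supported at `w` form a subgroup. -/
def atPlace (w : InfinitePlace k) : Subgroup (GA W) where
  carrier := {g | IsAtPlace W w g}
  one_mem' := ⟨fun v => map_one _, fun w' _ => map_one _⟩
  mul_mem' := by
    rintro g h ⟨hg1, hg2⟩ ⟨hh1, hh2⟩
    exact ⟨fun v => by rw [map_mul, hg1 v, hh1 v, one_mul],
      fun w' hw' => by rw [map_mul, hg2 w' hw', hh2 w' hw', one_mul]⟩
  inv_mem' := by
    rintro g ⟨hg1, hg2⟩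
    exact ⟨fun v => by rw [map_inv, hg1 v, inv_one], fun w' hw' => by rw [map_inv, hg2 w' hw', inv_one]⟩

/-- **The local torus at `w`**: the elements of the torus `T` supported at `w` (`T(k_w) = U(W_a)_w × U(W_b)_w`
embedded at the place `w`). -/
def localTorusAt (w : InfinitePlace k) : Subgroup (GA W) := torusT W ⊓ atPlace W w

/-- The root `ω_w ∈ ℂ` of `X² − t X + n` with non-negative imaginary part, read through the embedding of `k_w`
into `ℂ` (for a CM extension `t² − 4n < 0` at every real place, so this is the root in the upper half plane). -/
def wroot (q : QuadData k) (w : InfinitePlace k) : ℂ :=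
  let ι := InfinitePlace.Completion.extensionEmbedding w
  (ι (algebraMap k w.Completion q.t) +
    Complex.I * Real.sqrt (4 * (ι (algebraMap k w.Completion q.n)).re - (ι (algebraMap k w.Completion q.t)).re ^ 2)) / 2

/-- The `(i, j)` entry of the `w`-component of `κ ∈ G(𝔸_k)`, as a complex number. -/
def entryAt (w : InfinitePlace k) (κ : GA W) (i j : Fin 4) : ℂ :=
  InfinitePlace.Completion.extensionEmbedding w
    (((GA.infiniteComponent W w κ : GL (Fin 4) w.Completion) : Matrix (Fin 4) (Fin 4) w.Completion) i j)

/-- The index of the first basis vector of the line `j` of the plane (`0` for `⟨a⟩ = k ⊕ k ω`, `2` for `⟨b⟩`). -/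
def lineBase (j : Fin 2) : Fin 4 := if j = 0 then 0 else 2

/-- The index of the `ω`-basis vector of the line `j`. -/
def lineOmega (j : Fin 2) : Fin 4 := if j = 0 then 1 else 3

/-- **The weight of `κ` on the line `j` at `w`**: the complex number by which the `w`-component of `κ` acts on the
line `⟨a_j⟩ ⊗ k_w ≅ ℂ` — the image of the basis vector `1` is `κ₀₀ · 1 + κ₁₀ · ω`, i.e. the complex number
`κ₀₀ + κ₁₀ ω_w` (for `κ` in the torus this block is `k_w`-linear and commutes with `ω`, so it IS multiplication by
this number). -/
def weightAt (q : QuadData k) (w : InfinitePlace k) (j : Fin 2) (κ : GA W) : ℂ :=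
  entryAt W w κ (lineBase j) (lineBase j) + entryAt W w κ (lineOmega j) (lineBase j) * wroot q w

/-- **(β) `V` has the `K`-type `(e₊, e₋)` at `w`**: some non-zero `f ∈ V` transforms under the local torus at `w`
by `κ ↦ κ₊^{e₊} κ₋^{e₋}` (the weights of `κ` on the two lines of the plane). -/
def HasKTypeAt (q : QuadData k) (w : InfinitePlace k) (ePlus eMinus : ℤ) (V : Submodule ℂ (GA W → ℂ)) : Prop :=
  ∃ f ∈ V, f ≠ 0 ∧ ∀ (x : GA W) (κ : GA W), κ ∈ localTorusAt W w →
    f (x * κ) = weightAt W q w 0 κ ^ ePlus * weightAt W q w 1 κ ^ eMinus * f x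

end KType

section Transport

variable {k : Type} [Field k]

/-- **(γ) The plane with a transported second torus**: `Q i := g P i g⁻¹` for an `E′`-linear invertible `g`
(the seesaw isometry): `torusT'` of the result is `g (torusT) g⁻¹`. -/
def PlaneData.withTransportedTorus (W : PlaneData k) (g g' : Matrix (Fin 4) (Fin 4) k) (hgg' : g * g' = 1)
    (hg'g : g' * g = 1) (hgΩ : g * W.Ω = W.Ω * g) : PlaneData k where
  B := W.B
  Ω := W.Ω
  P := W.P
  Q := fun i => g * W.P i * g'
  B_symm := W.B_symm
  P_comm := W.P_comm
  Q_comm := by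
    intro i
    have hg'Ω : g' * W.Ω = W.Ω * g' := by
      calc g' * W.Ω = g' * W.Ω * (g * g') := by rw [hgg', Matrix.mul_one]
        _ = g' * (W.Ω * g) * g' := by simp only [Matrix.mul_assoc]
        _ = g' * (g * W.Ω) * g' := by rw [hgΩ]
        _ = W.Ω * g' := by rw [← Matrix.mul_assoc, hg'g, Matrix.one_mul]
    calc g * W.P i * g' * W.Ω = g * W.P i * (g' * W.Ω) := by simp only [Matrix.mul_assoc]
      _ = g * W.P i * (W.Ω * g') := by rw [hg'Ω]
      _ = g * (W.P i * W.Ω) * g' := by simp only [Matrix.mul_assoc]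
      _ = g * (W.Ω * W.P i) * g' := by rw [W.P_comm i]
      _ = (g * W.Ω) * W.P i * g' := by simp only [Matrix.mul_assoc]
      _ = W.Ω * (g * W.P i * g') := by rw [hgΩ]; simp only [Matrix.mul_assoc]
  P_idem := W.P_idem
  Q_idem := by
    intro i
    calc g * W.P i * g' * (g * W.P i * g') = g * W.P i * (g' * g) * W.P i * g' := by simp only [Matrix.mul_assoc]
      _ = g * (W.P i * W.P i) * g' := by rw [hg'g, Matrix.mul_one]; simp only [Matrix.mul_assoc]
      _ = g * W.P i * g' := by rw [W.P_idem i]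
  P_sum := W.P_sum
  Q_sum := by
    calc g * W.P 0 * g' + g * W.P 1 * g' = g * (W.P 0 + W.P 1) * g' := by
          simp only [Matrix.mul_add, Matrix.add_mul]
      _ = 1 := by rw [W.P_sum, Matrix.mul_one, hgg']

/-- The transported plane has the same underlying `B`, `Ω`, `P`. -/
theorem withTransportedTorus_P (W : PlaneData k) (g g' : Matrix (Fin 4) (Fin 4) k) (hgg' : g * g' = 1)
    (hg'g : g' * g = 1) (hgΩ : g * W.Ω = W.Ω * g) :
    (W.withTransportedTorus g g' hgg' hg'g hgΩ).P = W.P := rfl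

/-- The transported second projectors. -/
theorem withTransportedTorus_Q (W : PlaneData k) (g g' : Matrix (Fin 4) (Fin 4) k) (hgg' : g * g' = 1)
    (hg'g : g' * g = 1) (hgΩ : g * W.Ω = W.Ω * g) (i : Fin 2) :
    (W.withTransportedTorus g g' hgg' hg'g hgΩ).Q i = g * W.P i * g' := rfl

end Transport

/-! ## v0.2 (append): the transported torus's local torus, weights and `K`-types, and the exponent compatibility of a
character with a `K`-type (t4-plan-4's five V2 candidates, S12300) -/

section TransportedKType

variable {k : Type} [Field k] [NumberField k] (W : PlaneData k)

/-- The local torus of the SECOND torus at `w`: the elements of `T′` supported at `w`. -/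
def localTorusAt' (w : InfinitePlace k) : Subgroup (GA W) := torusT' W ⊓ atPlace W w

/-- The `(i, j)` entry, in `ℂ`, of `g′ κ_w g` — the `w`-component of `κ` conjugated back by the transport `g` (so that
the transported lines become the coordinate blocks). -/
def entryAtConj (w : InfinitePlace k) (g g' : Matrix (Fin 4) (Fin 4) k) (κ : GA W) (i j : Fin 4) : ℂ :=
  InfinitePlace.Completion.extensionEmbedding w
    ((g'.map (algebraMap k w.Completion) *
      ((GA.infiniteComponent W w κ : GL (Fin 4) w.Completion) : Matrix (Fin 4) (Fin 4) w.Completion) *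
      g.map (algebraMap k w.Completion)) i j)

/-- The weight of `κ` on the transported line `j` at `w` (the block of `g′ κ_w g`). -/
def weightAt' (q : QuadData k) (w : InfinitePlace k) (g g' : Matrix (Fin 4) (Fin 4) k) (j : Fin 2) (κ : GA W) : ℂ :=
  entryAtConj W w g g' κ (lineBase j) (lineBase j) + entryAtConj W w g g' κ (lineOmega j) (lineBase j) * wroot q w

/-- `V` has the `K`-type `(e₊, e₋)` at `w` for the TRANSPORTED torus. -/
def HasKTypeAt' (q : QuadData k) (w : InfinitePlace k) (g g' : Matrix (Fin 4) (Fin 4) k) (ePlus eMinus : ℤ)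
    (V : Submodule ℂ (GA W → ℂ)) : Prop :=
  ∃ f ∈ V, f ≠ 0 ∧ ∀ (x : GA W) (κ : GA W), κ ∈ localTorusAt' W w →
    f (x * κ) = weightAt' W q w g g' 0 κ ^ ePlus * weightAt' W q w g g' 1 κ ^ eMinus * f x

/-- **Exponent compatibility of a character with a `K`-type** at `w`: `χ(κ) · κ₊^{e₊} κ₋^{e₋} = 1` on the local torus
(the toric period against `χ` can be non-zero on a form of `K`-type `(e₊, e₋)` only if the archimedean component of
`χ` cancels the `K`-type). -/
def ChiMatchesAt (q : QuadData k) (w : InfinitePlace k) (ePlus eMinus : ℤ) (chi : torusT W → ℂ) : Prop :=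
  ∀ κ : torusT W, (κ : GA W) ∈ localTorusAt W w →
    chi κ * weightAt W q w 0 (κ : GA W) ^ ePlus * weightAt W q w 1 (κ : GA W) ^ eMinus = 1

/-- The primed twin on the transported torus. -/
def ChiMatchesAt' (q : QuadData k) (w : InfinitePlace k) (g g' : Matrix (Fin 4) (Fin 4) k) (ePlus eMinus : ℤ)
    (chi' : torusT' W → ℂ) : Prop :=
  ∀ κ : torusT' W, (κ : GA W) ∈ localTorusAt' W w →
    chi' κ * weightAt' W q w g g' 0 (κ : GA W) ^ ePlus * weightAt' W q w g g' 1 (κ : GA W) ^ eMinus = 1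

end TransportedKType


end Summit.Ventures.HodgeRepro.Tier4.Common

end
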